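import Summits.RiemannHypothesis.RiemannHypothesis.Theorems.DBNKernelMasses
import Mathlib.Analysis.Calculus.ParametricIntervalIntegral
import Mathlib.Analysis.SpecialFunctions.ExpDeriv
import HarnessLib

/-!
# RiemannHypothesis / DBN — the kernels as real parts of holomorphic functions on the strip

RH-FREE complex analysis behind T1a (THEORY-R3 §6 of the `pub-dbn` cell): on the strip
`|Im z| < c` the smeared probe kernel is the real part of the parametric integral
`K(z) = ∫_{-1}^{1} φ(v)[(c + i(z-u-κv))⁻¹ + (c - i(z-u-κv))⁻¹] dv`, which is holomorphic there
(differentiation under the integral sign, `intervalIntegral.hasDerivAt_integral_of_dominated_loc_of_deriv_le`,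
with the derivative bound uniform on a ball), and the regularised descent kernel `P_ε` is the real
part of `Π_ε(z) = 2[((1+ε) + iz)⁻¹ + ((1+ε) - iz)⁻¹]`, holomorphic on `|Im z| < 1 + ε`.

* `re_probeIntegrandC`, `re_integral_probeC` : `Re K(ξ+iη) = S_{c,κ,u}(ξ,η)`;
* `differentiableAt_integral_probeC` : holomorphy of `K` on `|Im z| < c`;
* `continuous_probeKernel` : continuity of `ξ ↦ S(ξ,η)` for `|η| < c`;
* `re_descentC`, `differentiableAt_descentC` : the same for `P_ε`.

`--supports stmt-RiemannHypothesis-0274`; nothing here bears on the truth of RH.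
-/

noncomputable section

-- D-0017: `Summit.<S>.<S>.…` is the designed namespace of a single-problem summit.
set_option linter.dupNamespace false

open scoped Real
open MeasureTheory Set intervalIntegral

namespace Summit.RiemannHypothesis.RiemannHypothesis.Theorems.DbnTheory

/-! ## Complexification: the kernels are real parts of holomorphic functions on the strip -/

section complexify

open Complex

/-- Real part of the complex probe integrand: for `w = z - u - κv`,
`Re[(c + iw)⁻¹ + (c - iw)⁻¹] = (c-η)/((c-η)²+(ξ-u-κv)²) + (c+η)/((c+η)²+(ξ-u-κv)²)`, `z = ξ + iη`. [folklore] -/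
theorem re_probeIntegrandC (c κ u : ℝ) (z : ℂ) (v : ℝ) :
    (((biweight v : ℝ) : ℂ) * (((c : ℂ) + I * (z - u - κ * v))⁻¹ + ((c : ℂ) - I * (z - u - κ * v))⁻¹)).re
      = biweight v * ((c - z.im) / ((c - z.im)^2 + (z.re - u - κ * v)^2)
        + (c + z.im) / ((c + z.im)^2 + (z.re - u - κ * v)^2)) := by
  rw [re_ofReal_mul, add_re, inv_re, inv_re, normSq_apply, normSq_apply]
  simp only [add_re, sub_re, mul_re, ofReal_re, ofReal_im, I_re, I_im, add_im, sub_im, mul_im,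
    zero_mul, one_mul, mul_zero, sub_zero, zero_sub, add_zero, zero_add]
  ring

/-- On `|Im z| < c` the two denominators of the complex probe integrand do not vanish. [folklore] -/
theorem probeDenom_ne_zero (c κ u : ℝ) {z : ℂ} (hz : |z.im| < c) (v : ℝ) :
    (c : ℂ) + I * (z - u - κ * v) ≠ 0 ∧ (c : ℂ) - I * (z - u - κ * v) ≠ 0 := by
  have h1 := neg_abs_le z.im
  have h2 := le_abs_self z.im
  constructor
  · intro h
    have hre := congrArg Complex.re h
    simp only [add_re, ofReal_re, mul_re, I_re, I_im, sub_im, ofReal_im, mul_im, zero_mul, one_mul,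
      mul_zero, add_zero, zero_sub, sub_zero, zero_re] at hre
    linarith
  · intro h
    have hre := congrArg Complex.re h
    simp only [sub_re, ofReal_re, mul_re, I_re, I_im, sub_im, ofReal_im, mul_im, zero_mul, one_mul,
      mul_zero, add_zero, zero_sub, sub_zero, zero_re] at hre
    linarith

/-- Continuity in `v` of the complex probe integrand for `|Im z| < c`. [folklore] -/
theorem continuous_probeIntegrandC (c κ u : ℝ) {z : ℂ} (hz : |z.im| < c) :
    Continuous fun v : ℝ =>
      ((biweight v : ℝ) : ℂ) * (((c : ℂ) + I * (z - u - κ * v))⁻¹ + ((c : ℂ) - I * (z - u - κ * v))⁻¹) := by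
  refine (continuous_ofReal.comp continuous_biweight).mul (Continuous.add ?_ ?_)
  · exact Continuous.inv₀ (by fun_prop) fun v => (probeDenom_ne_zero c κ u hz v).1
  · exact Continuous.inv₀ (by fun_prop) fun v => (probeDenom_ne_zero c κ u hz v).2

/-- **`S = Re K`**: the smeared probe kernel is the real part of the holomorphic parametric integral
`K(z) = ∫ φ(v)[(c + i(z-u-κv))⁻¹ + (c - i(z-u-κv))⁻¹] dv` on the strip `|Im z| < c`. [folklore] -/
theorem re_integral_probeC (c κ u : ℝ) (z : ℂ) (hz : |z.im| < c) :
    (∫ v in (-1:ℝ)..1, ((biweight v : ℝ) : ℂ) *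
        (((c : ℂ) + I * (z - u - κ * v))⁻¹ + ((c : ℂ) - I * (z - u - κ * v))⁻¹)).re
      = probeKernel c κ u z.re z.im := by
  rw [← reCLM_apply (∫ v in (-1:ℝ)..1, _), ← ContinuousLinearMap.intervalIntegral_comp_comm _
    ((continuous_probeIntegrandC c κ u hz).intervalIntegrable _ _)]
  unfold probeKernel
  refine intervalIntegral.integral_congr fun v _ => ?_
  simp only [reCLM_apply]
  exact re_probeIntegrandC c κ u z v

/-- **Holomorphy of `K`** on the strip `|Im z| < c` (differentiation under the integral sign, the
`v`-derivative bound being uniform on a ball). [folklore] -/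
theorem differentiableAt_integral_probeC (c κ u : ℝ) {z₀ : ℂ} (hz₀ : |z₀.im| < c) :
    DifferentiableAt ℂ (fun z : ℂ => ∫ v in (-1:ℝ)..1, ((biweight v : ℝ) : ℂ) *
        (((c : ℂ) + I * (z - u - κ * v))⁻¹ + ((c : ℂ) - I * (z - u - κ * v))⁻¹)) z₀ := by
  set ρ : ℝ := (c - |z₀.im|) / 2 with hρ
  have hρ0 : 0 < ρ := by rw [hρ]; linarith
  have hstrip : ∀ z ∈ Metric.ball z₀ ρ, |z.im| < c - ρ := by
    intro z hz
    rw [Metric.mem_ball, dist_eq_norm] at hz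
    have h1 : |(z - z₀).im| ≤ ‖z - z₀‖ := abs_im_le_norm (z - z₀)
    rw [sub_im] at h1
    have h2 := abs_sub_abs_le_abs_sub z.im z₀.im
    rw [hρ] at hz ⊢
    linarith
  have hne : ∀ z ∈ Metric.ball z₀ ρ, ∀ v : ℝ,
      (c : ℂ) + I * (z - u - κ * v) ≠ 0 ∧ (c : ℂ) - I * (z - u - κ * v) ≠ 0 :=
    fun z hz v => probeDenom_ne_zero c κ u (by linarith [hstrip z hz]) v
  have hnorm : ∀ z ∈ Metric.ball z₀ ρ, ∀ v : ℝ,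
      ρ ≤ ‖(c : ℂ) + I * (z - u - κ * v)‖ ∧ ρ ≤ ‖(c : ℂ) - I * (z - u - κ * v)‖ := by
    intro z hz v
    have h := hstrip z hz
    have h1 := neg_abs_le z.im
    have h2 := le_abs_self z.im
    constructor
    · refine le_trans ?_ (re_le_norm _)
      simp only [add_re, ofReal_re, mul_re, I_re, I_im, sub_im, ofReal_im, mul_im, zero_mul, one_mul,
        mul_zero, add_zero, zero_sub, sub_zero]
      linarith
    · refine le_trans ?_ (re_le_norm _)
      simp only [sub_re, ofReal_re, mul_re, I_re, I_im, sub_im, ofReal_im, mul_im, zero_mul, one_mul,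
        mul_zero, add_zero, zero_sub, sub_zero]
      linarith
  have key := intervalIntegral.hasDerivAt_integral_of_dominated_loc_of_deriv_le
    (μ := volume) (a := -1) (b := 1) (𝕜 := ℂ) (E := ℂ) (x₀ := z₀) (s := Metric.ball z₀ ρ)
    (bound := fun _ => (ρ^2)⁻¹ + (ρ^2)⁻¹)
    (F := fun z v => ((biweight v : ℝ) : ℂ) *
        (((c : ℂ) + I * (z - u - κ * v))⁻¹ + ((c : ℂ) - I * (z - u - κ * v))⁻¹))
    (F' := fun z v => ((biweight v : ℝ) : ℂ) *
        (-I / ((c : ℂ) + I * (z - u - κ * v)) ^ 2 + -(-I) / ((c : ℂ) - I * (z - u - κ * v)) ^ 2))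
    (Metric.ball_mem_nhds z₀ hρ0) ?_ ?_ ?_ ?_ ?_ ?_
  · exact key.2.differentiableAt
  · -- measurability of `F z` near `z₀`
    refine Filter.eventually_of_mem (Metric.ball_mem_nhds z₀ hρ0) fun z hz => ?_
    exact (continuous_probeIntegrandC c κ u (by linarith [hstrip z hz])).aestronglyMeasurable
  · exact (continuous_probeIntegrandC c κ u hz₀).intervalIntegrable _ _
  · -- measurability of `F' z₀`
    have hz₀' : z₀ ∈ Metric.ball z₀ ρ := Metric.mem_ball_self hρ0
    refine (Continuous.mul (continuous_ofReal.comp continuous_biweight) (Continuous.add ?_ ?_)).aestronglyMeasurable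
    · exact Continuous.div continuous_const (by fun_prop) fun v => pow_ne_zero 2 (hne z₀ hz₀' v).1
    · exact Continuous.div continuous_const (by fun_prop) fun v => pow_ne_zero 2 (hne z₀ hz₀' v).2
  · -- the uniform bound on `F'`
    refine ae_of_all _ fun v _ z hz => ?_
    have hb0 := biweight_nonneg v
    have hb1 := biweight_le v
    have hA : ‖-I / ((c : ℂ) + I * (z - u - κ * v)) ^ 2‖ ≤ (ρ^2)⁻¹ := by
      rw [norm_div, norm_neg, norm_I, norm_pow, one_div]
      exact inv_anti₀ (by positivity) (pow_le_pow_left₀ hρ0.le (hnorm z hz v).1 2)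
    have hB : ‖-(-I) / ((c : ℂ) - I * (z - u - κ * v)) ^ 2‖ ≤ (ρ^2)⁻¹ := by
      rw [neg_neg, norm_div, norm_I, norm_pow, one_div]
      exact inv_anti₀ (by positivity) (pow_le_pow_left₀ hρ0.le (hnorm z hz v).2 2)
    calc ‖((biweight v : ℝ) : ℂ) * (-I / ((c : ℂ) + I * (z - u - κ * v)) ^ 2
            + -(-I) / ((c : ℂ) - I * (z - u - κ * v)) ^ 2)‖
        = |biweight v| * ‖-I / ((c : ℂ) + I * (z - u - κ * v)) ^ 2
            + -(-I) / ((c : ℂ) - I * (z - u - κ * v)) ^ 2‖ := by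
          rw [norm_mul, norm_real, Real.norm_eq_abs]
      _ ≤ 1 * ((ρ^2)⁻¹ + (ρ^2)⁻¹) := by
          refine mul_le_mul ?_ ((norm_add_le _ _).trans (add_le_add hA hB)) (norm_nonneg _) zero_le_one
          rw [abs_of_nonneg hb0]; linarith
      _ = (ρ^2)⁻¹ + (ρ^2)⁻¹ := one_mul _
  · exact intervalIntegrable_const
  · -- pointwise derivative
    refine ae_of_all _ fun v _ z hz => ?_
    have hdp : HasDerivAt (fun z : ℂ => (c : ℂ) + I * (z - u - κ * v)) I z := by
      have h := ((((hasDerivAt_id' z).sub_const (u : ℂ)).sub_const ((κ : ℂ) * (v : ℂ))).const_mul I).const_add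
        (c : ℂ)
      simpa using h
    have hdm : HasDerivAt (fun z : ℂ => (c : ℂ) - I * (z - u - κ * v)) (-I) z := by
      have h := ((((hasDerivAt_id' z).sub_const (u : ℂ)).sub_const ((κ : ℂ) * (v : ℂ))).const_mul I).const_sub
        (c : ℂ)
      simpa using h
    exact ((hdp.fun_inv (hne z hz v).1).fun_add (hdm.fun_inv (hne z hz v).2)).const_mul _

/-- Continuity of `ξ ↦ S_{c,κ,u}(ξ,η)` for `|η| < c` (restriction of the holomorphic `K` to a
horizontal line). [folklore] -/
theorem continuous_probeKernel (c κ u η : ℝ) (hη : |η| < c) :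
    Continuous fun ξ : ℝ => probeKernel c κ u ξ η := by
  have h : (fun ξ : ℝ => probeKernel c κ u ξ η) = fun ξ : ℝ => (∫ v in (-1:ℝ)..1, ((biweight v : ℝ) : ℂ) *
      (((c : ℂ) + I * (((ξ : ℂ) + η * I) - u - κ * v))⁻¹
        + ((c : ℂ) - I * (((ξ : ℂ) + η * I) - u - κ * v))⁻¹)).re := by
    funext ξ
    rw [re_integral_probeC c κ u ((ξ : ℂ) + η * I) (by simpa using hη)]
    simp
  rw [h]
  refine continuous_re.comp (continuous_iff_continuousAt.mpr fun ξ => ?_)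
  have hline : Continuous fun ξ : ℝ => (ξ : ℂ) + η * I := by fun_prop
  exact (differentiableAt_integral_probeC c κ u (z₀ := (ξ : ℂ) + η * I) (by simpa using hη)).continuousAt.comp
    (f := fun ξ : ℝ => (ξ : ℂ) + η * I) (x := ξ) hline.continuousAt

/-- Real part of the complexified regularised descent kernel:
`Re 2[((1+ε) + iz)⁻¹ + ((1+ε) - iz)⁻¹] = P_ε(Re z, Im z)`. [folklore] -/
theorem re_descentC (ε : ℝ) (z : ℂ) :
    (2 * ((((1 + ε : ℝ) : ℂ) + I * z)⁻¹ + (((1 + ε : ℝ) : ℂ) - I * z)⁻¹)).re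
      = descentKernelEps ε z.re z.im := by
  have h2 : (2 : ℂ) = ((2 : ℝ) : ℂ) := by norm_num
  rw [h2, re_ofReal_mul, add_re, inv_re, inv_re, normSq_apply, normSq_apply]
  unfold descentKernelEps
  simp only [add_re, sub_re, mul_re, ofReal_re, ofReal_im, I_re, I_im, add_im, sub_im, mul_im,
    zero_mul, one_mul, zero_sub, zero_add]
  ring

/-- On `|Im z| < 1 + ε` the denominators of the complexified `P_ε` do not vanish. [folklore] -/
theorem descentDenom_ne_zero (ε : ℝ) {z : ℂ} (hz : |z.im| < 1 + ε) :
    ((1 + ε : ℝ) : ℂ) + I * z ≠ 0 ∧ ((1 + ε : ℝ) : ℂ) - I * z ≠ 0 := by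
  have h1 := neg_abs_le z.im
  have h2 := le_abs_self z.im
  constructor
  · intro h
    have hre := congrArg Complex.re h
    simp only [add_re, ofReal_re, mul_re, I_re, I_im, zero_mul, one_mul, zero_sub, zero_re] at hre
    linarith
  · intro h
    have hre := congrArg Complex.re h
    simp only [sub_re, ofReal_re, mul_re, I_re, I_im, zero_mul, one_mul, zero_sub, zero_re] at hre
    linarith

/-- Holomorphy of the complexified `P_ε` on `|Im z| < 1 + ε`. [folklore] -/
theorem differentiableAt_descentC (ε : ℝ) {z : ℂ} (hz : |z.im| < 1 + ε) :
    DifferentiableAt ℂ (fun z : ℂ => 2 * ((((1 + ε : ℝ) : ℂ) + I * z)⁻¹ + (((1 + ε : ℝ) : ℂ) - I * z)⁻¹)) z := by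
  have h := descentDenom_ne_zero ε hz
  refine DifferentiableAt.const_mul (DifferentiableAt.fun_add ?_ ?_) _
  · exact DifferentiableAt.inv (by fun_prop) h.1
  · exact DifferentiableAt.inv (by fun_prop) h.2

end complexify

end Summit.RiemannHypothesis.RiemannHypothesis.Theorems.DbnTheory

end
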